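import Literature.Analysis.Complex.GraphContourDeformationDirection
import Literature.Analysis.Complex.GraphContourDeformationFirstCoordLocal
import HarnessLib

/-!
# Deformation of `ℝ^{n+1}` into a graph along a direction, localised

Topic `Literature/Analysis/Complex`. The localised companion of
`GraphContourDeformationDirection.lean`: the sweep hypothesis is required only over an open
convex `U₀ ⊆ ℝ^{n+1}` containing the support of the profile (by a rotation taking `e₀` to
`v/‖v‖`, from `integral_graph_deformation_firstCoord_sub_eq_zero`; the rotated `U₀` is again open
and convex):

  `∫ w, ((1 + i ∂ᵥφ(w)) • Ψ(cx w + iφ(w)v) - Ψ(cx w)) = 0`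
  (`integral_graph_deformation_direction_sub_eq_zero`).

## References

* Z. Grujić, I. Kukavica, J. Funct. Anal. 152 (1998), §2. [GrujicKukavica1998]
* Z. Bradshaw, Z. Grujić, I. Kukavica, J. Differential Equations 259 (2015), §3. [BradshawGrujicKukavica2015]
-/

noncomputable section

open MeasureTheory Set Function Filter Metric
open _root_.Topology
open _root_.Complex (I)
open Literature.Analysis.FunctionSpaces.EuclideanSpace (complexify complexify_apply)

namespace Literature.Analysis.Complex

variable {G : Type*} [NormedAddCommGroup G] [NormedSpace ℂ G] [CompleteSpace G]

/-- **Deformation of `ℝ^{n+1}` into a graph along the direction `v`, localised.** Let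
`Ψ : ℂ^{n+1} → G` be holomorphic on an open `U`, `v ∈ ℝ^{n+1}`, `φ : ℝ^{n+1} → ℝ` of class `C¹`
with compact support inside an open convex `U₀`, and assume the graphs `cx w + iθφ(w)v`,
`0 ≤ θ ≤ 1`, over `w ∈ U₀` lie in `U`. If the difference of the integrands is integrable, then
`∫ w, ((1 + i ∂ᵥφ(w)) • Ψ(cx w + iφ(w)v) - Ψ(cx w)) = 0`. [folklore] -/
theorem integral_graph_deformation_direction_sub_eq_zero {n : ℕ}
    {Ψ : EuclideanSpace ℂ (Fin (n + 1)) → G} {U : Set (EuclideanSpace ℂ (Fin (n + 1)))}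
    (hU : IsOpen U) (hΨ : DifferentiableOn ℂ Ψ U) (v : EuclideanSpace ℝ (Fin (n + 1)))
    {φ : EuclideanSpace ℝ (Fin (n + 1)) → ℝ} (hφ : ContDiff ℝ 1 φ) (hφc : HasCompactSupport φ)
    {U₀ : Set (EuclideanSpace ℝ (Fin (n + 1)))} (hU₀ : IsOpen U₀) (hU₀c : Convex ℝ U₀)
    (hsupp : tsupport φ ⊆ U₀)
    (hsweep : ∀ w ∈ U₀, ∀ θ ∈ Icc (0 : ℝ) 1,
      complexify w + I • complexify ((θ * φ w) • v) ∈ U)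
    (hint : Integrable fun w : EuclideanSpace ℝ (Fin (n + 1)) =>
      ((1 : ℂ) + I * ((fderiv ℝ φ w v : ℝ) : ℂ)) • Ψ (complexify w + I • complexify (φ w • v)) -
        Ψ (complexify w)) :
    ∫ w : EuclideanSpace ℝ (Fin (n + 1)),
        (((1 : ℂ) + I * ((fderiv ℝ φ w v : ℝ) : ℂ)) • Ψ (complexify w + I • complexify (φ w • v)) -
          Ψ (complexify w)) = 0 := by
  rcases eq_or_ne v 0 with rfl | hv
  · refine integral_eq_zero_of_ae (Eventually.of_forall fun w => ?_)
    simp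
  set Df : EuclideanSpace ℝ (Fin (n + 1)) → G := fun w =>
    ((1 : ℂ) + I * ((fderiv ℝ φ w v : ℝ) : ℂ)) •
      Ψ (complexify w + I • complexify (φ w • v)) - Ψ (complexify w) with hDf
  -- the unit vector `u = v/‖v‖` and an isometry `Q` with `Q e₀ = u`
  have hvn : 0 < ‖v‖ := norm_pos_iff.2 hv
  set u : EuclideanSpace ℝ (Fin (n + 1)) := ‖v‖⁻¹ • v with hu
  have hun : ‖u‖ = 1 := by
    rw [hu, norm_smul, norm_inv, norm_norm, inv_mul_cancel₀ hvn.ne']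
  set e₀ : EuclideanSpace ℝ (Fin (n + 1)) := EuclideanSpace.single 0 1 with he₀
  have he₀n : ‖e₀‖ = 1 := by
    rw [he₀]
    exact (PiLp.norm_single 2 (fun _ : Fin (n + 1) => ℝ) 0 (1 : ℝ)).trans norm_one
  set Q : EuclideanSpace ℝ (Fin (n + 1)) ≃ₗᵢ[ℝ] EuclideanSpace ℝ (Fin (n + 1)) :=
    (ℝ ∙ (e₀ - u))ᗮ.reflection with hQdef
  have hQe : Q e₀ = u := Submodule.reflection_sub (by rw [he₀n, hun])
  have hvu : ‖v‖ • u = v := by rw [hu, smul_smul, mul_inv_cancel₀ hvn.ne', one_smul]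
  -- the complexification of `Q`
  set QC : EuclideanSpace ℂ (Fin (n + 1)) → EuclideanSpace ℂ (Fin (n + 1)) := fun ζ =>
    complexify (Q.toLinearEquiv.toLinearMap
      (WithLp.toLp 2 (fun i => (ζ i).re) : EuclideanSpace ℝ (Fin (n + 1)))) +
      I • complexify (Q.toLinearEquiv.toLinearMap
        (WithLp.toLp 2 (fun i => (ζ i).im) : EuclideanSpace ℝ (Fin (n + 1)))) with hQC
  have hQClin : IsLinearMap ℂ QC := isLinearMap_complexification Q.toLinearEquiv.toLinearMap
  have hQCcont : Continuous QC := by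
    have : QC = (hQClin.mk' :
        EuclideanSpace ℂ (Fin (n + 1)) →ₗ[ℂ] EuclideanSpace ℂ (Fin (n + 1))) := rfl
    rw [this]
    exact LinearMap.continuous_of_finiteDimensional _
  have hQCdiff : Differentiable ℂ QC := by
    have : QC = ((hQClin.mk' : EuclideanSpace ℂ (Fin (n + 1)) →ₗ[ℂ]
        EuclideanSpace ℂ (Fin (n + 1))).toContinuousLinearMap :
          EuclideanSpace ℂ (Fin (n + 1)) →L[ℂ] EuclideanSpace ℂ (Fin (n + 1))) := rfl
    rw [this]
    exact ContinuousLinearMap.differentiable _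
  have hQCpt : ∀ a b : EuclideanSpace ℝ (Fin (n + 1)),
      QC (complexify a + I • complexify b) = complexify (Q a) + I • complexify (Q b) :=
    fun a b => complexification_complexify_add_I_smul Q.toLinearEquiv.toLinearMap a b
  have hQCreal : ∀ a : EuclideanSpace ℝ (Fin (n + 1)), QC (complexify a) = complexify (Q a) := by
    intro a
    have h := hQCpt a 0
    simpa using h
  -- transported data
  set Ψ' : EuclideanSpace ℂ (Fin (n + 1)) → G := Ψ ∘ QC with hΨ'
  set U' : Set (EuclideanSpace ℂ (Fin (n + 1))) := QC ⁻¹' U with hU'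
  set φ' : EuclideanSpace ℝ (Fin (n + 1)) → ℝ := fun w => ‖v‖ * φ (Q w) with hφ'
  have hU'open : IsOpen U' := hU.preimage hQCcont
  have hΨ'diff : DifferentiableOn ℂ Ψ' U' := hΨ.comp hQCdiff.differentiableOn fun ζ hζ => hζ
  have hQcont : ContDiff ℝ 1 (fun w => Q w) := Q.toContinuousLinearEquiv.contDiff
  have hQd : ∀ w, DifferentiableAt ℝ (fun w => Q w) w := fun w =>
    Q.toContinuousLinearEquiv.differentiableAt
  have hQfd : ∀ w, fderiv ℝ (fun w => Q w) w =
      (Q.toContinuousLinearEquiv : EuclideanSpace ℝ (Fin (n + 1)) →L[ℝ] _) := fun w =>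
    Q.toContinuousLinearEquiv.fderiv
  have hφ'C : ContDiff ℝ 1 φ' := contDiff_const.mul (hφ.comp hQcont)
  have hφ'c : HasCompactSupport φ' := (hφc.comp_homeomorph Q.toHomeomorph).mul_left
  -- the key pointwise identities
  have hpt : ∀ (w : EuclideanSpace ℝ (Fin (n + 1))) (s : ℝ),
      QC (complexify w + I • complexify ((s * φ' w) • e₀)) =
        complexify (Q w) + I • complexify ((s * φ (Q w)) • v) := by
    intro w s
    rw [hQCpt, LinearIsometryEquiv.map_smul, hQe, hφ', hu, smul_smul]
    congr 3
    field_simp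
  have hderiv : ∀ w : EuclideanSpace ℝ (Fin (n + 1)),
      fderiv ℝ φ' w e₀ = fderiv ℝ φ (Q w) v := by
    intro w
    have hd : DifferentiableAt ℝ φ (Q w) := (hφ.differentiable (by simp)) _
    have h1 : fderiv ℝ (fun w => φ (Q w)) w = (fderiv ℝ φ (Q w)).comp
        (Q.toContinuousLinearEquiv : EuclideanSpace ℝ (Fin (n + 1)) →L[ℝ] _) := by
      rw [← hQfd w]
      exact fderiv_comp w hd (hQd w)
    have h2 : fderiv ℝ φ' w = ‖v‖ • fderiv ℝ (fun w => φ (Q w)) w := by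
      rw [hφ', show (fun w => ‖v‖ * φ (Q w)) = fun w => ‖v‖ • φ (Q w) from rfl]
      exact fderiv_const_smul (hd.comp w (hQd w)) ‖v‖
    rw [h2, FunLike.coe_smul, Pi.smul_apply, h1, ContinuousLinearMap.comp_apply, smul_eq_mul]
    change ‖v‖ * fderiv ℝ φ (Q w) (Q e₀) = _
    rw [hQe, ← smul_eq_mul, ← ContinuousLinearMap.map_smul, hvu]
  -- hypotheses of the first-coordinate theorem
  -- the rotated support neighbourhood
  set U₀' : Set (EuclideanSpace ℝ (Fin (n + 1))) := (fun w => Q w) ⁻¹' U₀ with hU₀'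
  have hU₀'open : IsOpen U₀' := hU₀.preimage Q.continuous
  have hU₀'c : Convex ℝ U₀' := hU₀c.linear_preimage Q.toLinearEquiv.toLinearMap
  have hsupp' : tsupport φ' ⊆ U₀' := by
    have h1 : tsupport φ' ⊆ (fun w => Q w) ⁻¹' tsupport φ :=
      closure_minimal (fun w hw => subset_tsupport φ (by
        have : φ (Q w) ≠ 0 := fun h => hw (by simp [hφ', h])
        exact this)) ((isClosed_tsupport φ).preimage Q.continuous)
    exact h1.trans (preimage_mono hsupp)
  have hsweep' : ∀ w ∈ U₀', ∀ θ ∈ Icc (0 : ℝ) 1,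
      complexify w + I • complexify ((θ * φ' w) • e₀) ∈ U' := by
    intro w hw θ hθ
    show QC _ ∈ U
    rw [hpt]
    exact hsweep (Q w) hw θ hθ
  have hmp : MeasurePreserving (fun w => Q w) volume volume := Q.measurePreserving
  have hQemb : MeasurableEmbedding fun w => Q w := Q.toHomeomorph.measurableEmbedding
  have hDcomp : (fun w : EuclideanSpace ℝ (Fin (n + 1)) =>
      ((1 : ℂ) + I * ((fderiv ℝ φ' w e₀ : ℝ) : ℂ)) •
        Ψ' (complexify w + I • complexify (φ' w • e₀)) - Ψ' (complexify w)) = Df ∘ fun w => Q w := by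
    funext w
    simp only [Function.comp_apply, hΨ', hderiv, hDf, hQCreal]
    have h := hpt w 1
    rw [one_mul, one_mul] at h
    rw [h]
  have hint' : Integrable fun w : EuclideanSpace ℝ (Fin (n + 1)) =>
      ((1 : ℂ) + I * ((fderiv ℝ φ' w e₀ : ℝ) : ℂ)) •
        Ψ' (complexify w + I • complexify (φ' w • e₀)) - Ψ' (complexify w) := by
    rw [hDcomp]
    exact (hmp.integrable_comp_emb hQemb).2 hint
  have key := integral_graph_deformation_firstCoord_sub_eq_zero hU'open hΨ'diff hφ'C hφ'c hU₀'open
    hU₀'c hsupp' hsweep' hint'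
  rw [hDcomp] at key
  have eD : ∫ w, (Df ∘ fun w => Q w) w = ∫ w, Df w := hmp.integral_comp hQemb Df
  rw [eD] at key
  exact key

end Literature.Analysis.Complex
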